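import Summits.ResolutionOfSingularities.ResolutionOfSingularities.Theorems.FrobeniusClosingPatchingRelPerfectThreeLetterTower
import Summits.ResolutionOfSingularities.ResolutionOfSingularities.Theorems.FrobeniusClosingPatchingRelPerfectCoreRungTowerCharts
import Summits.ResolutionOfSingularities.ResolutionOfSingularities.Theorems.FrobeniusClosingPatchingRelPerfectPointBlowupChartAssembly
import Summits.ResolutionOfSingularities.ResolutionOfSingularities.Theorems.FrobeniusClosingPatchingRelPerfectCoreRungSquarePlusLinearCharts
import HarnessLib

/-!
# Crux `PatchingRelPerfect` (stmt-ResolutionOfSingularities-16161), chain w52 — rung toolkit: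
# the LETTER TOWER (three-letter tower with repeated factors and two idle hypotheses removed)

[OURS · L1 W5.2 · rung tool] `…ThreeLetterTower` proves that every blowing up of `Spec R` along the
flag product `∏_{s<N} (c, λ_{w 0} ⋯ λ_{w s})`, `λ ∈ {ℓ, o}`, is regular under `H'(R; c, ℓ, o)`.  The
companion design of the contact-migration member (this seat's PLAN-A2-certificate.md, addendum 3)
needs two refinements, PROVED here:

* letters in `{ℓ, o, 1}` — a letter `1` repeats the previous factor (`(c,w)(c,w)(c,wh)…`), which is
  what the other charts of the point blow-up produce (`(h, u)³ (h, u²)`); a repeated factor becomes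
  the unit ideal one level up, so the induction goes through unchanged (`letterTower_one`);
* the hypotheses `R/(c)` regular and `R/(c, ℓ, o)` a domain of `H'` only reproduce themselves along
  the tower and are DROPPED: the tower theorem `isRegular_of_isBlowup_letterTower` assumes only
  `H''(R; c, ℓ, o)`: `R` a regular domain, `(c,ℓ)`, `(c,o)` quasi-regular with regular integral
  quotients, `ℓ`, `o` regular modulo `c`, `ℓ ≠ 0`, `o ∉ (c,ℓ)`, `ℓ ∉ (c,o)`.

The letters are an arbitrary sequence `L : ℕ → R` with `L r ∈ {ℓ, o, 1}`; the flag product is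
`∏_{s<N} (c, L 0 ⋯ L s)`.  Arbitrary regular domains.  FORMAT evidence for the core stub only;
nothing here is a statement of the manuscript under review.

## References

* The Stacks Project, Tags 080A, 080B, 0804, 0BIQ. [StacksProject]
* Q. Liu, *Algebraic Geometry and Arithmetic Curves*, OUP 2002, Thm. 8.1.19 (a). [Liu2002]
* U. Görtz, T. Wedhorn, *Algebraic Geometry I*, 2nd ed. 2020, Prop. 13.91 (2), 13.96 (2), (13.19). [GortzWedhorn2020]
-/

-- `Summit.<Summit>.<Sub>.Theorems` with `Sub = Summit` (single-conjunct summit, D-0017)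
set_option linter.dupNamespace false

noncomputable section

open CategoryTheory CategoryTheory.Limits AlgebraicGeometry Literature.AlgebraicGeometry.Resolution
open IsLocalRing

namespace Summit.ResolutionOfSingularities.ResolutionOfSingularities.Theorems

namespace ConeRung

universe u

/-! ## Ideal algebra of the letter flag (any commutative rings) -/

section Algebra

variable {R B : Type*} [CommRing R] [CommRing B]

/-- **One step up**: `∏_{s<N+1} (c, L 0 ⋯ L s) = (∏_{s<N} (c, L 0 ⋯ L (s+1))) · (c, L 0)`. [folklore] -/
theorem letterTower_succ (c : R) (L : ℕ → R) (N : ℕ) :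
    ∏ s ∈ Finset.range (N + 1), Ideal.span {c, ∏ r ∈ Finset.range (s + 1), L r} =
      (∏ s ∈ Finset.range N, Ideal.span {c, ∏ r ∈ Finset.range (s + 2), L r}) *
        Ideal.span {c, L 0} := by
  rw [Finset.prod_range_succ', Finset.prod_range_one]

/-- **A letter `1` in front is dropped**: if `L 0 = 1` then
`∏_{s<N+1} (c, L 0 ⋯ L s) = ∏_{s<N} (c, L 1 ⋯ L (s+1))`. [folklore] -/
theorem letterTower_one (c : R) (L : ℕ → R) (hL0 : L 0 = 1) (N : ℕ) :
    ∏ s ∈ Finset.range (N + 1), Ideal.span {c, ∏ r ∈ Finset.range (s + 1), L r} =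
      ∏ s ∈ Finset.range N, Ideal.span {c, ∏ r ∈ Finset.range (s + 1), L (r + 1)} := by
  rw [letterTower_succ, hL0, Ideal.span_insert, Ideal.span_singleton_one, sup_top_eq,
    ← Ideal.one_eq_top, mul_one]
  refine Finset.prod_congr rfl fun s _ => ?_
  rw [Finset.prod_range_succ', hL0, mul_one]

/-- **The tail on the letter's chart**: if `ψ c = l c'`, `ψ (L 0) = l`, then
`ψ(∏_{s<N} (c, L 0 ⋯ L (s+1))) = (lᴺ) · ∏_{s<N} (c', ψ(L 1) ⋯ ψ(L (s+1)))`.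
[cite: StacksProject, Tag 080B] -/
theorem map_letterTail (ψ : R →+* B) (c : R) (L : ℕ → R) (l c' : B) (hc : ψ c = l * c')
    (hl : ψ (L 0) = l) (N : ℕ) :
    (∏ s ∈ Finset.range N, Ideal.span {c, ∏ r ∈ Finset.range (s + 2), L r}).map ψ =
      Ideal.span {l ^ N} *
        ∏ s ∈ Finset.range N, Ideal.span {c', ∏ r ∈ Finset.range (s + 1), ψ (L (r + 1))} := by
  rw [CoreRungTower.map_prod_range]
  have hfac : ∀ s : ℕ, (Ideal.span {c, ∏ r ∈ Finset.range (s + 2), L r}).map ψ =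
      Ideal.span {l} * Ideal.span {c', ∏ r ∈ Finset.range (s + 1), ψ (L (r + 1))} := fun s => by
    rw [Ideal.map_span, Set.image_pair, hc, map_prod, Finset.prod_range_succ', hl]
    exact span_pair_mul_eq l c' _
  simp_rw [hfac]
  rw [Finset.prod_mul_distrib, Finset.prod_const, Finset.card_range, Ideal.span_singleton_pow]

/-- **The tail on the `c`-chart**: if `ψ c = a`, `ψ (L 0) = a g`, then
`ψ(∏_{s<N} (c, L 0 ⋯ L (s+1))) = (aᴺ)`. [cite: StacksProject, Tag 080B] -/
theorem map_letterTail_eq_span_pow (ψ : R →+* B) (c : R) (L : ℕ → R) (a g : B)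
    (hc : ψ c = a) (hl : ψ (L 0) = a * g) (N : ℕ) :
    (∏ s ∈ Finset.range N, Ideal.span {c, ∏ r ∈ Finset.range (s + 2), L r}).map ψ =
      Ideal.span {a ^ N} := by
  rw [CoreRungTower.map_prod_range]
  have hfac : ∀ s : ℕ, (Ideal.span {c, ∏ r ∈ Finset.range (s + 2), L r}).map ψ =
      Ideal.span {a} := fun s => by
    rw [Ideal.map_span, Set.image_pair, hc, map_prod, Finset.prod_range_succ', hl]
    exact span_pair_eq_of_mul a g _
  simp_rw [hfac]
  rw [Finset.prod_const, Finset.card_range, Ideal.span_singleton_pow]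

end Algebra

/-! ## The letter tower theorem -/

/-- **The letter tower is regular.**  `R` a regular domain, `c, ℓ, o ∈ R` with `H''(R; c, ℓ, o)`:
`(c,ℓ)`, `(c,o)` quasi-regular, `R/(c,ℓ)`, `R/(c,o)` regular domains, `ℓ`, `o` regular modulo `c`,
`ℓ ≠ 0`, `o ∉ (c,ℓ)`, `ℓ ∉ (c,o)`; `L : ℕ → R` any letter sequence with values in `{ℓ, o, 1}`.  Then
every blowing up of `Spec R` along `∏_{s<N} (c, L 0 ⋯ L s)` is a regular scheme.  Induction on `N`
over all data: a front letter `1` is dropped (`letterTower_one`); a front letter `ℓ` is the blow-up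
of `V(c, ℓ)` (chartwise assembly 080A; `c`-chart Cartier, `ℓ`-chart `(ℓ'ᴺ)·` the tower of
`(c', ℓ', o')` with letters `ψ ∘ L ∘ succ`, where `H''` holds again by `step_*`, `stepP_*`); a front
letter `o` is the case `ℓ` for `(c, o, ℓ)`. [cite: StacksProject, Tag 080A]
[cite: StacksProject, Tag 080B] [cite: Liu2002, Thm. 8.1.19 (a)] [cite: GortzWedhorn2020, Prop. 13.96 (2)] -/
theorem isRegular_of_isBlowup_letterTower (N : ℕ) :
    ∀ {R : Type u} [CommRing R] [IsRegularRing R] [IsDomain R] (c ℓ o : R) (L : ℕ → R),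
      (∀ r, L r = ℓ ∨ L r = o ∨ L r = 1) →
      IsQuasiRegular (Fin.cons c (fun _ : Fin 1 => ℓ) : Fin 2 → R) →
      IsQuasiRegular (Fin.cons c (fun _ : Fin 1 => o) : Fin 2 → R) →
      IsDomain (R ⧸ Ideal.span {c, ℓ}) → IsRegularRing (R ⧸ Ideal.span {c, ℓ}) →
      IsDomain (R ⧸ Ideal.span {c, o}) → IsRegularRing (R ⧸ Ideal.span {c, o}) →
      IsSMulRegular (R ⧸ Ideal.span {c}) ℓ → IsSMulRegular (R ⧸ Ideal.span {c}) o →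
      ℓ ≠ 0 → o ∉ Ideal.span {c, ℓ} → ℓ ∉ Ideal.span {c, o} →
      ∀ {Y : Scheme.{u}} {f : Y ⟶ Spec (.of R)},
        IsBlowup f (affineBlowup.idealSheaf (∏ s ∈ Finset.range N,
          Ideal.span {c, ∏ r ∈ Finset.range (s + 1), L r})) →
        Scheme.IsRegular Y := by
  induction N with
  | zero =>
    intro R _ _ _ c ℓ o L _ _ _ _ _ _ _ _ _ _ _ _ Y f hf
    rw [Finset.prod_range_zero, Ideal.one_eq_top, affineBlowup.idealSheaf_top] at hf
    haveI : IsIso f := hf.isIso isEffectiveCartier_top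
    haveI : IsRegularRing (CommRingCat.of R) := inferInstanceAs (IsRegularRing R)
    exact SectionAscent.TraceIdeal.isRegular_of_iso (asIso f) (Scheme.isRegular_Spec _)
  | succ N ih =>
    -- the case `L 0 = ℓ` (blow up `V(c, ℓ)` first), for all data
    have key : ∀ {R : Type u} [CommRing R] [IsRegularRing R] [IsDomain R] (c ℓ o : R)
        (L : ℕ → R), (∀ r, L r = ℓ ∨ L r = o ∨ L r = 1) → L 0 = ℓ →
        IsQuasiRegular (Fin.cons c (fun _ : Fin 1 => ℓ) : Fin 2 → R) →
        IsDomain (R ⧸ Ideal.span {c, ℓ}) → IsRegularRing (R ⧸ Ideal.span {c, ℓ}) →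
        IsDomain (R ⧸ Ideal.span {c, o}) → IsRegularRing (R ⧸ Ideal.span {c, o}) →
        IsSMulRegular (R ⧸ Ideal.span {c}) ℓ → IsSMulRegular (R ⧸ Ideal.span {c}) o →
        ℓ ≠ 0 → o ∉ Ideal.span {c, ℓ} → ℓ ∉ Ideal.span {c, o} →
        ∀ {Y : Scheme.{u}} {f : Y ⟶ Spec (.of R)},
          IsBlowup f (affineBlowup.idealSheaf (∏ s ∈ Finset.range (N + 1),
            Ideal.span {c, ∏ r ∈ Finset.range (s + 1), L r})) →
          Scheme.IsRegular Y := by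
      intro R _ _ _ c ℓ o L hL hL0 hcl hDl hRl hDo hRo hℓc hoc hℓ0 ho hℓ Y f hf
      haveI := hDl; haveI := hRl; haveI := hDo; haveI := hRo
      haveI : IsRegularRing (R ⧸ Ideal.span (Set.range (Fin.cons c (fun _ : Fin 1 => ℓ) :
          Fin 2 → R))) := IsRegularRing.of_ringEquiv (Ideal.quotEquivOfEq (step_span_pair_eq c ℓ))
      rw [letterTower_succ c L N, hL0, step_span_pair_eq c ℓ] at hf
      -- the `c`-chart: the tail is the Cartier divisor `(c̄ᴺ)`
      have h0 : ∀ (Y' : Scheme.{u})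
          (ρ : Y' ⟶ Spec (.of (chartRing (Fin.cons c (fun _ : Fin 1 => ℓ) : Fin 2 → R) 0))),
          IsBlowup ρ (affineBlowup.idealSheaf ((∏ s ∈ Finset.range N,
            Ideal.span {c, ∏ r ∈ Finset.range (s + 2), L r}).map
              (chartBase (Fin.cons c (fun _ : Fin 1 => ℓ) : Fin 2 → R) 0))) →
            Scheme.IsRegular Y' := by
        intro Y' ρ hρ
        haveI : IsRegularRing (chartRing (Fin.cons c (fun _ : Fin 1 => ℓ) : Fin 2 → R) 0) :=
          isRegularRing_blowupChart _ 0 hcl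
        have hc0 : chartBase (Fin.cons c (fun _ : Fin 1 => ℓ) : Fin 2 → R) 0 c ∈
            nonZeroDivisors _ :=
          reesChartBase_mem_nonZeroDivisors ((Fin.cons c (fun _ : Fin 1 => ℓ) : Fin 2 → R) 0)
            (Ideal.mem_span_range_self (f := (Fin.cons c (fun _ : Fin 1 => ℓ) : Fin 2 → R))
              (x := 0))
        have hl : chartBase (Fin.cons c (fun _ : Fin 1 => ℓ) : Fin 2 → R) 0 (L 0) =
            chartBase (Fin.cons c (fun _ : Fin 1 => ℓ) : Fin 2 → R) 0 c *
              chartGen (Fin.cons c (fun _ : Fin 1 => ℓ) : Fin 2 → R) 0 (Fin.succ 0) := by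
          rw [hL0]
          exact reesChartBase_apply_eq_mul_chartGen (Fin.cons c (fun _ : Fin 1 => ℓ) : Fin 2 → R)
            0 (Fin.succ 0)
        rw [map_letterTail_eq_span_pow (chartBase (Fin.cons c (fun _ : Fin 1 => ℓ) :
            Fin 2 → R) 0) c L _ _ rfl hl N] at hρ
        exact isRegular_of_isBlowup_idealSheaf_span_singleton_of_isRegularRing (pow_mem hc0 N) hρ
      -- the `ℓ`-chart: `(ℓ'ᴺ) ·` the tower of `(c', ℓ', o')` with letters `ψ ∘ L ∘ succ`
      have h1 : ∀ (Y' : Scheme.{u})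
          (ρ : Y' ⟶ Spec (.of (chartRing (Fin.cons c (fun _ : Fin 1 => ℓ) : Fin 2 → R)
            (Fin.succ 0)))),
          IsBlowup ρ (affineBlowup.idealSheaf ((∏ s ∈ Finset.range N,
            Ideal.span {c, ∏ r ∈ Finset.range (s + 2), L r}).map
              (chartBase (Fin.cons c (fun _ : Fin 1 => ℓ) : Fin 2 → R) (Fin.succ 0)))) →
            Scheme.IsRegular Y' := by
        intro Y' ρ hρ
        haveI : IsRegularRing (chartRing (Fin.cons c (fun _ : Fin 1 => ℓ) : Fin 2 → R)
          (Fin.succ 0)) := step_isRegularRing c ℓ hcl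
        haveI : IsDomain (chartRing (Fin.cons c (fun _ : Fin 1 => ℓ) : Fin 2 → R)
          (Fin.succ 0)) := step_isDomain c ℓ hℓ0
        have hlz : chartBase (Fin.cons c (fun _ : Fin 1 => ℓ) : Fin 2 → R) (Fin.succ 0) ℓ ∈
            nonZeroDivisors _ :=
          reesChartBase_mem_nonZeroDivisors
            ((Fin.cons c (fun _ : Fin 1 => ℓ) : Fin 2 → R) (Fin.succ 0))
            (Ideal.mem_span_range_self (f := (Fin.cons c (fun _ : Fin 1 => ℓ) : Fin 2 → R))
              (x := Fin.succ 0))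
        have hl : chartBase (Fin.cons c (fun _ : Fin 1 => ℓ) : Fin 2 → R) (Fin.succ 0) (L 0) =
            chartBase (Fin.cons c (fun _ : Fin 1 => ℓ) : Fin 2 → R) (Fin.succ 0) ℓ := by
          rw [hL0]
        rw [map_letterTail (chartBase (Fin.cons c (fun _ : Fin 1 => ℓ) : Fin 2 → R)
            (Fin.succ 0)) c L _ _
          (reesChartBase_apply_eq_mul_chartGen (Fin.cons c (fun _ : Fin 1 => ℓ) : Fin 2 → R)
            (Fin.succ 0) 0) hl N] at hρ
        have ho' := step_o'_notMem c ℓ o hcl ho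
        have hL' : ∀ r, chartBase (Fin.cons c (fun _ : Fin 1 => ℓ) : Fin 2 → R) (Fin.succ 0)
            (L (r + 1)) = chartBase (Fin.cons c (fun _ : Fin 1 => ℓ) : Fin 2 → R) (Fin.succ 0) ℓ ∨
            chartBase (Fin.cons c (fun _ : Fin 1 => ℓ) : Fin 2 → R) (Fin.succ 0) (L (r + 1)) =
              chartBase (Fin.cons c (fun _ : Fin 1 => ℓ) : Fin 2 → R) (Fin.succ 0) o ∨
            chartBase (Fin.cons c (fun _ : Fin 1 => ℓ) : Fin 2 → R) (Fin.succ 0)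
              (L (r + 1)) = 1 := fun r => by
          rcases hL (r + 1) with h | h | h
          · exact Or.inl (by rw [h])
          · exact Or.inr (Or.inl (by rw [h]))
          · exact Or.inr (Or.inr (by rw [h, map_one]))
        exact CoreRungTower.isRegular_of_isBlowup_span_singleton_mul (pow_mem hlz N) _
          (fun Y'' ρ' hρ' => ih _ _ _ (fun r => chartBase (Fin.cons c (fun _ : Fin 1 => ℓ) :
              Fin 2 → R) (Fin.succ 0) (L (r + 1))) hL'
            (stepP_isQuasiRegular_c'ℓ' c ℓ hcl hℓ0)
            (stepP_isQuasiRegular_c'o' c ℓ o hcl hℓ0 hℓc hoc)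
            (step_isDomain_quot_c'ℓ' c ℓ hcl) (step_isRegularRing_quot_c'ℓ' c ℓ hcl)
            (stepP_isDomain_quot_c'o' c ℓ o hcl hℓc) (stepP_isRegularRing_quot_c'o' c ℓ o hcl hℓc)
            (stepP_isSMulRegular_ℓ' c ℓ hcl hℓ0) (stepP_isSMulRegular_o' c ℓ o hcl hℓc hoc)
            (nonZeroDivisors.ne_zero hlz) ho' (stepP_ℓ'_notMem c ℓ o hcl hℓc hℓ) hρ') hρ
      exact isRegular_of_isBlowup_mul_of_charts (Fin.cons c (fun _ : Fin 1 => ℓ) : Fin 2 → R) _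
        (fun i => Fin.cases (motive := fun i => ∀ (Y' : Scheme.{u})
          (ρ : Y' ⟶ Spec (.of (chartRing (Fin.cons c (fun _ : Fin 1 => ℓ) : Fin 2 → R) i))),
          IsBlowup ρ (affineBlowup.idealSheaf ((∏ s ∈ Finset.range N,
            Ideal.span {c, ∏ r ∈ Finset.range (s + 2), L r}).map
              (chartBase (Fin.cons c (fun _ : Fin 1 => ℓ) : Fin 2 → R) i))) →
            Scheme.IsRegular Y') h0 (fun k => by
              obtain rfl : k = 0 := Subsingleton.elim _ _
              exact h1) i) hf
    -- the general case
    intro R _ _ _ c ℓ o L hL hcl hco hDl hRl hDo hRo hℓc hoc hℓ0 ho hℓ Y f hf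
    rcases hL 0 with h | h | h
    · exact key c ℓ o L hL h hcl hDl hRl hDo hRo hℓc hoc hℓ0 ho hℓ hf
    · have ho0 : o ≠ 0 := fun h0 => ho (h0 ▸ Ideal.zero_mem _)
      exact key c o ℓ L (fun r => by rcases hL r with h' | h' | h' <;> simp only [h', true_or, or_true])
        h hco hDo hRo hDl hRl hoc hℓc ho0 hℓ ho hf
    · -- a front letter `1`: the first factor is the unit ideal
      rw [letterTower_one c L h N] at hf
      exact ih c ℓ o (fun r => L (r + 1)) (fun r => hL (r + 1)) hcl hco hDl hRl hDo hRo hℓc hoc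
        hℓ0 ho hℓ hf

end ConeRung

end Summit.ResolutionOfSingularities.ResolutionOfSingularities.Theorems

end
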